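import Literature.Computability.FineGrained.EditDistOVRun
import Literature.Computability.FineGrained.LCSFromOVReduction
import Literature.Computability.FineGrained.DiameterOVReduction
import HarnessLib

/-!
# OV → binary edit distance on the word RAM, IV: the OV algorithm from a subquadratic edit-distance algorithm, and fine-grained.S14

The assembly of the machine part of Bringmann–Künnemann's / Backurs–Indyk's SETH lower bound for
the Levenshtein distance of two **binary** strings (A. Backurs, P. Indyk, *Edit distance cannot be
computed in strongly subquadratic time (unless SETH is false)*, STOC 2015, Thm. 1 / Thm. 3 of the
arXiv version; K. Bringmann, M. Künnemann, FOCS 2015, Thm. 1.2 via Thm. 3.3 with §5.2) in the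
deterministic word-RAM model of this library:

* `EDRed.Geo.BND_le`, `EDRed.BND_lt_two_pow`, `EDRed.Ttot_le`: every constant of the reduction
  program is `O((n+1)(d+1))`, a word size of `64 ·` input width holds them, and the program runs in
  `O((n+1)(d+1))` steps;
* **`ovInTimePolyDim_of_editDistance_inTimeO_holds`**: the discharge of the named fact
  `ovInTimePolyDim_of_editDistance_inTimeO` of `…FineGrained.EditDistanceSETH`: a deterministic
  `O(N^{2-ε})` word-RAM algorithm for binary edit distance (`0 < ε ≤ 1`) gives an
  `O((n+1)^{2-ε} (d+1)^2)` word-RAM algorithm for Orthogonal Vectors. The OV algorithm is the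
  generic inline simulation `Inline.SIM` (`…Cryptography.WordRAMInline3`) of the verified oracle
  program `EDRed.M` (`EditDistOVRun`: it writes `(ovX I, ovY I)`, asks ONE edit-distance query of
  total length `O((n+1)(d+1))`, and compares the answer with the threshold), with the query answered
  by an inline run of the hypothetical edit-distance program; since there is a single query, the
  simulation costs `O((n+1)(d+1)) + 38 · (C M^{2-ε} + C)` with `M = |x| + |y| = O((n+1)(d+1))`, i.e.
  the SAME exponent `2 - ε` (no loss, unlike the generic transfer property of fine-grained
  reductions);
* **`not_editDistance_inTimeO_of_sethWordRAM_holds`**: the discharge of fine-grained.S14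
  (`not_editDistance_inTimeO_of_sethWordRAM` of `…FineGrained.SETHHardness`) by the proved assembly
  `not_editDistance_inTimeO_of_sethWordRAM_of` from word-RAM SETH ⇒ OVH
  (`ovhWordRAM_of_sethWordRAM_holds`, Williams' split-and-list reduction, `OVPolyDimProofs`) and
  the above.

## References

* A. Backurs, P. Indyk, STOC 2015 (arXiv:1412.0348), Thm. 1; Thm. 3 (`EDIT` in `O(n^{2-δ})` ⇒ OV
  in `d^{O(1)} N^{2-δ}`), §3 (the reduction).
* K. Bringmann, M. Künnemann, FOCS 2015 (arXiv:1502.01063), Thm. 1.2, §2.1 (OVH, Lemma 2.1),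
  Thm. 3.3 (proof §3.1), Lemmas 5.2–5.4.
* V. Vassilevska Williams, Proc. ICM 2018, §2 (the word RAM; algorithms calling an algorithm).
-/

namespace Literature.Computability.FineGrained

open Cryptography Cryptography.WordRAM Cryptography.WordRAM.SProg FGProblem BKGadget BKReduction

/-! ### The constants of the program are `O((n+1)(d+1))` -/

namespace EDRed.Geo

variable (g : Geo)

/-- `m p ≤ 2c (n+1)(d+1)` for `p ≤ c (d+1)`, `m ≤ 2(n+1)`. [folklore] -/
theorem mul_le_area {p c m : ℕ} (hp : p ≤ c * (g.d + 1)) (hm : m ≤ 2 * (g.n + 1)) :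
    m * p ≤ 2 * c * ((g.n + 1) * (g.d + 1)) :=
  calc m * p ≤ (2 * (g.n + 1)) * (c * (g.d + 1)) := Nat.mul_le_mul hm hp
    _ = 2 * c * ((g.n + 1) * (g.d + 1)) := by ring

/-- **Every constant of the run is `O((n+1)(d+1))`.** [folklore] -/
theorem BND_le (hD : g.D = 2 + 2 * (g.n * g.d) + 100) :
    g.BND ≤ 10000000000000000 * ((g.n + 1) * (g.d + 1)) := by
  obtain ⟨e1, e2, e3, e4, e5, e6, e7, e8, e9, e10⟩ := g.params_le
  have e11 : g.q₃.γ₃ ≤ 22410314400 * (g.d + 1) := by rw [g.q₃_γ₃]; omega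
  have hnd : g.n * g.d ≤ (g.n + 1) * (g.d + 1) := Nat.mul_le_mul (by omega) (by omega)
  have hd1 : g.d + 1 ≤ (g.n + 1) * (g.d + 1) := Nat.le_mul_of_pos_left _ (by omega)
  have hn1 : g.n + 1 ≤ (g.n + 1) * (g.d + 1) := Nat.le_mul_of_pos_right _ (by omega)
  have aF₂ : g.F₂ ≤ 1413600 * (g.d + 1) := by unfold Geo.F₂; omega
  have aF₃ : g.F₃ ≤ 3733638800 * (g.d + 1) := by unfold Geo.F₃; omega
  have apad₁ : g.pad₁ ≤ 4820 * (g.d + 1) := by unfold Geo.pad₁; omega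
  have apad₂ : g.pad₂ ≤ 16963200 * (g.d + 1) := by unfold Geo.pad₂; omega
  have aG₂x : g.G₂x ≤ 2831215 * (g.d + 1) := by unfold Geo.G₂x; omega
  have aG₂y : g.G₂y ≤ 2840855 * (g.d + 1) := by unfold Geo.G₂y; omega
  have aG₃ : g.G₃ ≤ 7477180830 * (g.d + 1) := by unfold Geo.G₃; omega
  have aG₃y : g.G₃y ≤ 7504044855 * (g.d + 1) := by unfold Geo.G₃y; omega
  have aper₂ : g.per₂ ≤ 7072015 * (g.d + 1) := by unfold Geo.per₂; omega
  have aper₃ : g.per₃ ≤ 18682338030 * (g.d + 1) := by unfold Geo.per₃; omega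
  have aper₃y : g.per₃y ≤ 18709202055 * (g.d + 1) := by unfold Geo.per₃y; omega
  have aC₂ : g.C₂ ≤ 33926400 * (g.d + 1) := by unfold Geo.C₂; omega
  have aC₁ : g.C₁ ≤ 9640 * (g.d + 1) := by unfold Geo.C₁; omega
  have aρ₀ : g.rho₀ ≤ 33936044 * (g.d + 1) := by unfold Geo.rho₀; omega
  have aρ₁ : g.rho₁ ≤ 33936046 * (g.d + 1) := by unfold Geo.rho₁; omega
  -- the `(n+1)(d+1)` quantities
  have aLX : g.LX ≤ 37364676060 * ((g.n + 1) * (g.d + 1)) := by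
    unfold Geo.LX
    have a := g.mul_le_area aG₃ (le_refl (2 * (g.n + 1)))
    have b := g.mul_le_area e10 (le_refl (2 * (g.n + 1)))
    have : (g.n + g.n) * g.G₃ ≤ 2 * (g.n + 1) * g.G₃ := Nat.mul_le_mul_right _ (by omega)
    have : (g.n + g.n - 1) * g.q₃.γ₂ ≤ 2 * (g.n + 1) * g.q₃.γ₂ := Nat.mul_le_mul_right _ (by omega)
    omega
  have aLC : g.LC ≤ 18709202055 * ((g.n + 1) * (g.d + 1)) := by
    unfold Geo.LC
    have a := g.mul_le_area aG₃y (show g.n ≤ 2 * (g.n + 1) by omega)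
    have b := g.mul_le_area e10 (show g.n - 1 ≤ 2 * (g.n + 1) by omega)
    have ha : g.n * g.G₃y ≤ (g.n + 1) * (7504044855 * (g.d + 1)) := Nat.mul_le_mul (by omega) aG₃y
    have hb : (g.n - 1) * g.q₃.γ₂ ≤ (g.n + 1) * (11205157200 * (g.d + 1)) := Nat.mul_le_mul (by omega) e10
    have e : (g.n + 1) * (7504044855 * (g.d + 1)) + (g.n + 1) * (11205157200 * (g.d + 1)) =
        18709202055 * ((g.n + 1) * (g.d + 1)) := by ring
    omega
  have aNP : g.NP ≤ 44820628800 * ((g.n + 1) * (g.d + 1)) := by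
    unfold Geo.NP
    have := g.mul_le_area e11 (le_refl (2 * (g.n + 1)))
    have : (g.n + g.n) * g.q₃.γ₃ ≤ 2 * (g.n + 1) * g.q₃.γ₃ := Nat.mul_le_mul_right _ (by omega)
    omega
  have aLY : g.LY ≤ 108350459655 * ((g.n + 1) * (g.d + 1)) := by unfold Geo.LY; omega
  have aL : g.L = 2 + 2 * (g.n * g.d) := by unfold Geo.L; omega
  have aQ : g.Q ≤ 109 * ((g.n + 1) * (g.d + 1)) := by unfold Geo.Q; omega
  have aLEN : g.LEN ≤ 145715135716 * ((g.n + 1) * (g.d + 1)) := by unfold Geo.LEN; omega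
  have anγ : g.n * g.q₃.γ₂ ≤ 11205157200 * ((g.n + 1) * (g.d + 1)) := by
    calc g.n * g.q₃.γ₂ ≤ (g.n + 1) * (11205157200 * (g.d + 1)) := Nat.mul_le_mul (by omega) e10
      _ = _ := by ring
  have aFn : (g.F₃ + g.q₃.sx) * g.n ≤ 3736467606 * ((g.n + 1) * (g.d + 1)) := by
    calc (g.F₃ + g.q₃.sx) * g.n ≤ (3736467606 * (g.d + 1)) * (g.n + 1) := Nat.mul_le_mul (by omega) (by omega)
      _ = _ := by ring
  have aC₃ : g.C₃ ≤ 89641257600 * ((g.n + 1) * (g.d + 1)) := by unfold Geo.C₃; omega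
  have aρ : g.rho ≤ 157513349736 * ((g.n + 1) * (g.d + 1)) := by
    unfold Geo.rho
    have : (g.n - 1) * g.rho₁ ≤ (g.n + 1) * (33936046 * (g.d + 1)) := Nat.mul_le_mul (by omega) aρ₁
    have e : (g.n + 1) * (33936046 * (g.d + 1)) = 33936046 * ((g.n + 1) * (g.d + 1)) := by ring
    omega
  unfold Geo.BND
  omega

end EDRed.Geo

namespace EDRed

/-- **The word size `64 · width` holds every constant of the run.** [folklore] -/
theorem BND_lt_two_pow (I : OVInstance) : (geo I).BND < 2 ^ (64 * inputWidth (OV.encode I)) := by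
  have hB := (geo I).BND_le (geo_D I)
  rw [(geo_nd I).1, (geo_nd I).2] at hB
  set w := inputWidth (OV.encode I) with hw
  have hw1 : 1 ≤ w := inputWidth_pos _
  have hn : I.n < 2 ^ w := lt_two_pow_inputWidth_of_mem _ _ (by rw [OV_encode_eq]; simp)
  have hd : I.d < 2 ^ w := lt_two_pow_inputWidth_of_mem _ _ (by rw [OV_encode_eq]; simp)
  have hT : (I.n + 1) * (I.d + 1) ≤ 2 ^ w * 2 ^ w := Nat.mul_le_mul hn hd
  have h54 : (10000000000000000 : ℕ) < 2 ^ 54 := by norm_num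
  have h1 : 2 ^ 54 * (2 ^ w * 2 ^ w) ≤ 2 ^ (64 * w) := by
    rw [← pow_add, ← pow_add]
    exact Nat.pow_le_pow_right (by norm_num) (by omega)
  have hpos : 0 < 2 ^ w * 2 ^ w := by positivity
  calc (geo I).BND ≤ 10000000000000000 * ((I.n + 1) * (I.d + 1)) := hB
    _ < 2 ^ 54 * (2 ^ w * 2 ^ w) := by
        calc 10000000000000000 * ((I.n + 1) * (I.d + 1)) ≤ 10000000000000000 * (2 ^ w * 2 ^ w) :=
              Nat.mul_le_mul_left _ hT
          _ < 2 ^ 54 * (2 ^ w * 2 ^ w) := Nat.mul_lt_mul_of_pos_right h54 hpos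
    _ ≤ 2 ^ (64 * w) := h1

/-- The two lengths are `O((n+1)(d+1))`. [folklore] -/
theorem LX_LY_le (I : OVInstance) :
    (geo I).LX ≤ 37364676060 * ((I.n + 1) * (I.d + 1)) ∧ (geo I).LY ≤ 108350459655 * ((I.n + 1) * (I.d + 1)) := by
  obtain ⟨-, -, -, -, -, e6, e7, -, e9, e10⟩ := (geo I).params_le
  have e11 : (geo I).q₃.γ₃ ≤ 22410314400 * ((geo I).d + 1) := by rw [(geo I).q₃_γ₃]; omega
  have aF₃ : (geo I).F₃ ≤ 3733638800 * ((geo I).d + 1) := by unfold Geo.F₃; omega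
  have aG₃ : (geo I).G₃ ≤ 7477180830 * ((geo I).d + 1) := by unfold Geo.G₃; omega
  have aG₃y : (geo I).G₃y ≤ 7504044855 * ((geo I).d + 1) := by unfold Geo.G₃y; omega
  have aLX : (geo I).LX ≤ 37364676060 * (((geo I).n + 1) * ((geo I).d + 1)) := by
    unfold Geo.LX
    have a := (geo I).mul_le_area aG₃ (le_refl (2 * ((geo I).n + 1)))
    have b := (geo I).mul_le_area e10 (le_refl (2 * ((geo I).n + 1)))
    have : ((geo I).n + (geo I).n) * (geo I).G₃ ≤ 2 * ((geo I).n + 1) * (geo I).G₃ :=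
      Nat.mul_le_mul_right _ (by omega)
    have : ((geo I).n + (geo I).n - 1) * (geo I).q₃.γ₂ ≤ 2 * ((geo I).n + 1) * (geo I).q₃.γ₂ :=
      Nat.mul_le_mul_right _ (by omega)
    omega
  have aLC : (geo I).LC ≤ 18709202055 * (((geo I).n + 1) * ((geo I).d + 1)) := by
    unfold Geo.LC
    have ha : (geo I).n * (geo I).G₃y ≤ ((geo I).n + 1) * (7504044855 * ((geo I).d + 1)) :=
      Nat.mul_le_mul (by omega) aG₃y
    have hb : ((geo I).n - 1) * (geo I).q₃.γ₂ ≤ ((geo I).n + 1) * (11205157200 * ((geo I).d + 1)) :=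
      Nat.mul_le_mul (by omega) e10
    have e : ((geo I).n + 1) * (7504044855 * ((geo I).d + 1)) + ((geo I).n + 1) * (11205157200 * ((geo I).d + 1)) =
        18709202055 * (((geo I).n + 1) * ((geo I).d + 1)) := by ring
    omega
  have aNP : (geo I).NP ≤ 44820628800 * (((geo I).n + 1) * ((geo I).d + 1)) := by
    unfold Geo.NP
    have := (geo I).mul_le_area e11 (le_refl (2 * ((geo I).n + 1)))
    have : ((geo I).n + (geo I).n) * (geo I).q₃.γ₃ ≤ 2 * ((geo I).n + 1) * (geo I).q₃.γ₃ :=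
      Nat.mul_le_mul_right _ (by omega)
    omega
  have aLY : (geo I).LY ≤ 108350459655 * (((geo I).n + 1) * ((geo I).d + 1)) := by unfold Geo.LY; omega
  exact ⟨aLX, aLY⟩

/-- **The total time is `O((n+1)(d+1))`.** [folklore] -/
theorem Ttot_le (I : OVInstance) : Ttot I + 1 ≤ 10000000000000 * ((I.n + 1) * (I.d + 1)) := by
  obtain ⟨aLX, aLY⟩ := LX_LY_le I
  have hnd : I.n * I.d ≤ (I.n + 1) * (I.d + 1) := Nat.mul_le_mul (by omega) (by omega)
  have hT1 : 1 ≤ (I.n + 1) * (I.d + 1) := Nat.one_le_iff_ne_zero.2 (by positivity)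
  unfold Ttot
  omega

/-! ### The lengths of the query -/

/-- `|x| + |y| ≤ 1.5 · 10¹¹ (n+1)(d+1)`, `|q| = LEN ≤ 1.5 · 10¹¹ (n+1)(d+1)`. [folklore] -/
theorem lengths_le (I : OVInstance) (hn : 0 < I.n) :
    (ovX I).length + (ovY I).length ≤ 145715135715 * ((I.n + 1) * (I.d + 1)) ∧
    (encodeBoolPair (ovX I, ovY I)).length = (geo I).LEN ∧
    (geo I).LEN ≤ 145715135716 * ((I.n + 1) * (I.d + 1)) := by
  obtain ⟨aLX, aLY⟩ := LX_LY_le I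
  have hLX := length_ovX_eq (geo I) I (geo_nd I) hn
  have hLY := length_ovY_eq (geo I) I (geo_nd I)
  have hT1 : 1 ≤ (I.n + 1) * (I.d + 1) := Nat.one_le_iff_ne_zero.2 (by positivity)
  refine ⟨by rw [hLX, hLY]; omega, by simp [encodeBoolPair, Geo.LEN, hLX, hLY], by unfold Geo.LEN; omega⟩

/-! ### The run of the oracle program as a `HaltsWithin` certificate -/

/-- **The oracle program `M` on `OV.encode I`** with any oracle answering `EditDistance`: at word
size `64 · width` it halts within `Ttot I + 1` steps with read-out `[1]`/`[0]` according to
`HasOrthogonalPair`, having asked at most the one query `encodeBoolPair (ovX I, ovY I)`. [folklore] -/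
theorem M_haltsWithin (I : OVInstance) {O : List ℕ → List ℕ} (hO : EditDistance.OracleAnswers O) :
    ∃ c : Cfg, HaltsWithin M (64 * inputWidth (OV.encode I)) O zeroCoins (OV.encode I) (Ttot I + 1) c ∧
      readOut c.mem = [if I.HasOrthogonalPair then 1 else 0] ∧
      c.queries = (if I.n = 0 then [] else [encodeBoolPair (ovX I, ovY I)]) := by
  have hw : inputWidth (OV.encode I) ≤ 64 * inputWidth (OV.encode I) := inputWidth_le_mul (by norm_num) _
  obtain ⟨st, t, ht, hex, hout, hq⟩ := prog_exec (W := 64 * inputWidth (OV.encode I)) I (BND_lt_two_pow I) hO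
  rw [← init_mem_eq_initFun hw] at hex
  exact ⟨st.cfg none 0, haltsWithin_toProgram hex (by omega) _, by simpa using hout, by simpa using hq⟩

/-! ### Real-number bookkeeping -/

/-- `((S : ℝ))^{2-ε} ≤ K² · (n+1)^{2-ε} (d+1)²` for `S ≤ K (n+1)(d+1)`, `0 < ε ≤ 1`. [folklore] -/
theorem rpow_len_le {S K n d : ℕ} {ε : ℝ} (hε : 0 < ε) (hε1 : ε ≤ 1) (hS : S ≤ K * ((n + 1) * (d + 1))) :
    ((S : ℕ) : ℝ) ^ (2 - ε) ≤ (K : ℝ) ^ (2 : ℕ) * ((((n : ℝ) + 1) ^ (2 - ε)) * ((d : ℝ) + 1) ^ (2 : ℕ)) := by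
  set a : ℝ := (n : ℝ) + 1 with ha
  set b : ℝ := (d : ℝ) + 1 with hb
  have ha1 : 1 ≤ a := by rw [ha]; have := (Nat.cast_nonneg n : (0:ℝ) ≤ n); linarith
  have hb1 : 1 ≤ b := by rw [hb]; have := (Nat.cast_nonneg d : (0:ℝ) ≤ d); linarith
  have ha0 : 0 ≤ a := by linarith
  have hb0 : 0 ≤ b := by linarith
  have hK0 : (0 : ℝ) ≤ K := Nat.cast_nonneg _
  have hSle : ((S : ℕ) : ℝ) ≤ K * (a * b) := by rw [ha, hb]; exact_mod_cast hS
  have hS0 : (0 : ℝ) ≤ ((S : ℕ) : ℝ) := Nat.cast_nonneg _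
  rcases Nat.eq_zero_or_pos K with hK | hK
  · subst hK
    have : S = 0 := by simpa using hS
    subst this
    simp [Real.zero_rpow (show (2 - ε) ≠ 0 by linarith)]
  have hK1 : (1 : ℝ) ≤ K := by exact_mod_cast hK
  calc ((S : ℕ) : ℝ) ^ (2 - ε) ≤ (K * (a * b)) ^ (2 - ε) := Real.rpow_le_rpow hS0 hSle (by linarith)
    _ = (K : ℝ) ^ (2 - ε) * (a ^ (2 - ε) * b ^ (2 - ε)) := by
        rw [Real.mul_rpow hK0 (by positivity), Real.mul_rpow ha0 hb0]
    _ ≤ (K : ℝ) ^ (2 : ℕ) * (a ^ (2 - ε) * b ^ (2 : ℕ)) := by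
        have h2 : (K : ℝ) ^ (2 - ε) ≤ (K : ℝ) ^ (2 : ℕ) := by
          calc (K : ℝ) ^ (2 - ε) ≤ (K : ℝ) ^ ((2 : ℕ) : ℝ) :=
                Real.rpow_le_rpow_of_exponent_le hK1 (by norm_num; linarith)
            _ = (K : ℝ) ^ (2 : ℕ) := Real.rpow_natCast _ 2
        have hb2 : b ^ (2 - ε) ≤ b ^ (2 : ℕ) := by
          calc b ^ (2 - ε) ≤ b ^ ((2 : ℕ) : ℝ) := Real.rpow_le_rpow_of_exponent_le hb1 (by norm_num; linarith)
            _ = b ^ (2 : ℕ) := Real.rpow_natCast b 2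
        have ha2 : 0 ≤ a ^ (2 - ε) := Real.rpow_nonneg ha0 _
        have hbb : 0 ≤ b ^ (2 - ε) := Real.rpow_nonneg hb0 _
        calc (K : ℝ) ^ (2 - ε) * (a ^ (2 - ε) * b ^ (2 - ε)) ≤ (K : ℝ) ^ (2 : ℕ) * (a ^ (2 - ε) * b ^ (2 - ε)) :=
              mul_le_mul_of_nonneg_right h2 (mul_nonneg ha2 hbb)
          _ ≤ (K : ℝ) ^ (2 : ℕ) * (a ^ (2 - ε) * b ^ (2 : ℕ)) := by
              apply mul_le_mul_of_nonneg_left _ (by positivity)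
              exact mul_le_mul_of_nonneg_left hb2 ha2

/-- `(n+1)(d+1) ≤ (n+1)^{2-ε} (d+1)²` and `1 ≤ (n+1)^{2-ε} (d+1)²` for `ε ≤ 1`. [folklore] -/
theorem area_le_P (n d : ℕ) {ε : ℝ} (hε1 : ε ≤ 1) :
    (((n + 1) * (d + 1) : ℕ) : ℝ) ≤ (((n : ℝ) + 1) ^ (2 - ε)) * ((d : ℝ) + 1) ^ (2 : ℕ) ∧
    (1 : ℝ) ≤ (((n : ℝ) + 1) ^ (2 - ε)) * ((d : ℝ) + 1) ^ (2 : ℕ) := by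
  set a : ℝ := (n : ℝ) + 1 with ha
  set b : ℝ := (d : ℝ) + 1 with hb
  have ha1 : 1 ≤ a := by rw [ha]; have := (Nat.cast_nonneg n : (0:ℝ) ≤ n); linarith
  have hb1 : 1 ≤ b := by rw [hb]; have := (Nat.cast_nonneg d : (0:ℝ) ≤ d); linarith
  have ha0 : 0 ≤ a := by linarith
  have hb0 : 0 ≤ b := by linarith
  have haP : a ≤ a ^ (2 - ε) := by
    calc a = a ^ (1 : ℝ) := (Real.rpow_one a).symm
      _ ≤ a ^ (2 - ε) := Real.rpow_le_rpow_of_exponent_le ha1 (by linarith)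
  have hbP : b ≤ b ^ (2 : ℕ) := by nlinarith
  have hab : a * b ≤ a ^ (2 - ε) * b ^ (2 : ℕ) := mul_le_mul haP hbP hb0 (le_trans ha0 haP)
  have hcast : (((n + 1) * (d + 1) : ℕ) : ℝ) = a * b := by rw [ha, hb]; push_cast; ring
  refine ⟨by rw [hcast]; exact hab, le_trans (by nlinarith) hab⟩

/-! ### The OV algorithm: fine-grained.S14's machine part -/

/-- **A subquadratic algorithm for binary edit distance solves OV in `n^{2-ε} poly(d)` time**
(the discharge of `ovInTimePolyDim_of_editDistance_inTimeO`; A. Backurs, P. Indyk, STOC 2015,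
Thm. 1 / Thm. 3 — "If `EDIT` can be computed in time `O(n^{2-δ})` … then OV … can be solved in time
`d^{O(1)} · N^{2-δ}`" — for the binary alphabet via K. Bringmann, M. Künnemann, FOCS 2015, Thm. 3.3
with Lemmas 5.2–5.4, read on the word RAM): if for some `0 < ε ≤ 1` binary edit distance has a
deterministic `O(N^{2-ε})`-time word-RAM algorithm `M_E`, then Orthogonal Vectors is decided on the
deterministic word RAM within `⌊C' ((n+1)^{2-ε} (d+1)^2)⌋₊` steps (`OVInTimePolyDim ε`, `c = 2`).
Proof: the oracle program `EDRed.M` writes the strings `ovX I`, `ovY I` of `EditDistanceOVGadgets`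
(`|x| + |y| ≤ 1.5·10¹¹ (n+1)(d+1)`), asks for their edit distance and accepts iff it is at most
`ovThreshold I` (`EDRed.prog_exec`, via `editDist_ovX_ovY_le_iff` and BK15 Lemma 5.4,
`alignmentGadget_editDist_holds`); the OV program is the inline simulation `Inline.SIM M 64 M_E k_E`
answering the single query by a run of `M_E` (`Inline.outputsWithin_SIM`, side conditions by
`sim_numerics`), whose cost is `O((n+1)(d+1)) + 38 (C (|x|+|y|)^{2-ε} + C) = O((n+1)^{2-ε}(d+1)^2)`.
[cite: BackursIndykSTOC2015, Thm. 1; Thm. 3 (§3)]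
[cite: BringmannKunnemannFOCS2015, Thm. 3.3 (proof §3.1) with Lemmas 5.2–5.4; Thm. 1.2] -/
theorem ovInTimePolyDim_of_editDistance_inTimeO_holds : ovInTimePolyDim_of_editDistance_inTimeO := by
  intro ε hε hε1 hED
  obtain ⟨C, MB, kB, hBdet, hBof, hMB⟩ := hED
  -- the oracle of the edit-distance algorithm, with its halting times
  obtain ⟨O, s, hO, hs⟩ := exists_oracle_of_algorithm hMB
  -- the constants of the simulation
  set G : ℕ := 46 with hG
  set c₁ : ℕ := G + 0 + 64 + Program.maxConst M + 2 with hc₁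
  set k' : ℕ := kB * c₁ + Program.maxConst MB + c₁ + G + 11 with hk'
  obtain ⟨K, hK⟩ : ∃ K : ℕ, K = 145715135715 := ⟨_, rfl⟩
  refine ⟨10000000000000000 * ((k' : ℝ) + 1) + 38 * max C 0 * ((K : ℝ) ^ (2 : ℕ) + 1), 2,
    Inline.SIM M 64 MB kB, k', Inline.SIM_isDeterministic _ _ _ _, Inline.SIM_isOracleFree _ _ _ _,
    fun (I : OVInstance) => ?_⟩
  set x := OV.encode I with hx
  set w := inputWidth x with hw
  have hw1 : 1 ≤ w := inputWidth_pos _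
  have hwidth : OV.width I = w := rfl
  -- the run of the oracle program
  obtain ⟨cM, hHalt, hout, hqs⟩ := M_haltsWithin I hO
  -- numerics
  have hT1 : Ttot I + 1 ≤ 2 ^ (G * w) := by
    have h1 := Ttot_le I
    have hn : I.n < 2 ^ w := lt_two_pow_inputWidth_of_mem _ _ (by rw [hx, OV_encode_eq]; simp)
    have hd : I.d < 2 ^ w := lt_two_pow_inputWidth_of_mem _ _ (by rw [hx, OV_encode_eq]; simp)
    have hT : (I.n + 1) * (I.d + 1) ≤ 2 ^ w * 2 ^ w := Nat.mul_le_mul hn hd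
    have h44 : (10000000000000 : ℕ) < 2 ^ 44 := by norm_num
    have h2 : 2 ^ 44 * (2 ^ w * 2 ^ w) ≤ 2 ^ (G * w) := by
      rw [← pow_add, ← pow_add]; exact Nat.pow_le_pow_right (by norm_num) (by omega)
    have hpos : 0 < 2 ^ w * 2 ^ w := by positivity
    calc Ttot I + 1 ≤ 10000000000000 * ((I.n + 1) * (I.d + 1)) := h1
      _ ≤ 10000000000000 * (2 ^ w * 2 ^ w) := Nat.mul_le_mul_left _ hT
      _ ≤ 2 ^ 44 * (2 ^ w * 2 ^ w) := Nat.mul_le_mul_right _ h44.le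
      _ ≤ 2 ^ (G * w) := h2
  obtain ⟨n2, n3, n4, n5, n6, n7, n8, n9, n10, n11, n12, -⟩ :=
    sim_numerics (Co := 0) (k := 64) (m := Program.maxConst M) (kB := kB) (mB := Program.maxConst MB)
      hw1 hT1 (length_lt_two_pow_inputWidth x) hc₁ hk'
  -- the queries
  have hqmem : ∀ q ∈ cM.queries, q = encodeBoolPair (ovX I, ovY I) ∧ 0 < I.n := fun q hq => by
    rw [hqs] at hq
    by_cases hn0 : I.n = 0
    · simp [hn0] at hq
    · simp only [hn0, if_false, List.mem_singleton] at hq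
      exact ⟨hq, Nat.pos_of_ne_zero hn0⟩
  have hsI := hs (ovX I, ovY I)
  have hencI : EditDistance.encode (ovX I, ovY I) = encodeBoolPair (ovX I, ovY I) := rfl
  have hansI : O (encodeBoolPair (ovX I, ovY I)) = [editDist (ovX I) (ovY I)] := by
    have := hO (ovX I, ovY I)
    simpa [EditDistance, FGProblem.ofFun] using this
  have hOq : ∀ q ∈ cM.queries, (O q).length ≤ 2 ^ (c₁ * w) - 1 := fun q hq => by
    obtain ⟨rfl, -⟩ := hqmem q hq
    rw [hansI]; simpa using n6
  have hMBq : ∀ q ∈ cM.queries, ∃ cB, HaltsWithin MB (kB * inputWidth q) noOracle zeroCoins q (s q) cB ∧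
      readOut cB.mem = O q := fun q hq => by
    obtain ⟨rfl, -⟩ := hqmem q hq
    rw [← hencI]; exact hsI.2
  -- the cost of the simulation
  set Tfin : ℕ := ⌊(10000000000000000 * ((k' : ℝ) + 1) + 38 * max C 0 * ((K : ℝ) ^ (2 : ℕ) + 1)) *
      ((((I.n : ℝ) + 1) ^ (2 - ε)) * ((I.d : ℝ) + 1) ^ (2 : ℕ))⌋₊ with hTfin
  have hTcost : Inline.simCost x.length (k' * w) (Ttot I + 1) ((cM.queries.map (Inline.charge (k' * w) O s)).sum)
      (readOut cM.mem).length ≤ Tfin := by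
    refine Nat.le_floor ?_
    set P : ℝ := (((I.n : ℝ) + 1) ^ (2 - ε)) * ((I.d : ℝ) + 1) ^ (2 : ℕ) with hP
    obtain ⟨habP, h1P⟩ := area_le_P I.n I.d (ε := ε) hε1
    rw [← hP] at habP h1P
    have hP0 : 0 ≤ P := le_trans zero_le_one h1P
    set Tn : ℕ := (I.n + 1) * (I.d + 1) with hTn
    -- ℕ-side bounds
    have hTt := Ttot_le I
    have hL : x.length = 2 + 2 * (I.n * I.d) := by rw [hx]; exact length_OV_encode I
    have hnd : I.n * I.d ≤ Tn := Nat.mul_le_mul (by omega) (by omega)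
    have hwle : w ≤ 3 * Tn := by rw [hw, hx]; exact inputWidth_OV_encode_le I
    have hsz : Nat.size (k' * w) ≤ 3 * (k' * Tn) := by
      calc Nat.size (k' * w) ≤ k' * w := CliqueRed.size_le_self _
        _ ≤ k' * (3 * Tn) := Nat.mul_le_mul_left _ hwle
        _ = 3 * (k' * Tn) := by ring
    have hro : (readOut cM.mem).length = 1 := by rw [hout]; rfl
    -- the charges: at most one query
    have hch : ((cM.queries.map (Inline.charge (k' * w) O s)).sum : ℕ) ≤
        20 * (145715135716 * Tn) + 20 * (3 * (k' * Tn)) +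
          38 * ⌊C * (((ovX I).length + (ovY I).length : ℕ) : ℝ) ^ (2 - ε) + C⌋₊ + 93 := by
      rw [hqs]
      by_cases hn0 : I.n = 0
      · simp [hn0]
      · have hn : 0 < I.n := Nat.pos_of_ne_zero hn0
        obtain ⟨-, hlenq, hLEN⟩ := lengths_le I hn
        simp only [hn0, if_false, List.map_cons, List.map_nil, List.sum_cons, List.sum_nil, Nat.add_zero,
          Inline.charge, Inline.qbCost, hansI, List.length_singleton, hlenq]
        have h1 : s (encodeBoolPair (ovX I, ovY I)) ≤
            ⌊C * (((ovX I).length + (ovY I).length : ℕ) : ℝ) ^ (2 - ε) + C⌋₊ := by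
          have := hsI.1; rwa [hencI] at this
        have h2 : (geo I).LEN ≤ 145715135716 * Tn := hLEN
        omega
    have hcost : (Inline.simCost x.length (k' * w) (Ttot I + 1) ((cM.queries.map (Inline.charge (k' * w) O s)).sum)
        (readOut cM.mem).length : ℕ) ≤
        10000000000000000 * (k' + 1) * Tn + 38 * ⌊C * (((ovX I).length + (ovY I).length : ℕ) : ℝ) ^ (2 - ε) + C⌋₊ := by
      simp only [Inline.simCost, Inline.proCost, widthCost, Inline.epiCost, cstep, hro]
      have hTn1 : 1 ≤ Tn := by rw [hTn]; exact Nat.one_le_iff_ne_zero.2 (by positivity)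
      have eK : 10000000000000000 * (k' + 1) * Tn = 10000000000000000 * (k' * Tn) + 10000000000000000 * Tn := by ring
      rw [eK]
      omega
    -- the edit-distance program's time, in `ℝ`
    set S : ℕ := (ovX I).length + (ovY I).length with hS
    have hSle : S ≤ K * ((I.n + 1) * (I.d + 1)) := by
      rw [hK]
      by_cases hn0 : I.n = 0
      · have hx0 : ovX I = [] := by
          have := length_ovX I; rw [hn0] at this; simpa using this
        have hy0 : ovY I = [] := by
          have := length_ovY I; rw [hn0] at this; simpa using this
        rw [hS, hx0, hy0]; simp
      · exact (lengths_le I (Nat.pos_of_ne_zero hn0)).1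
    have hpow : ((S : ℕ) : ℝ) ^ (2 - ε) ≤ (K : ℝ) ^ (2 : ℕ) * P := rpow_len_le hε hε1 hSle
    set C₀ := max C 0 with hC₀
    have hC₀0 : 0 ≤ C₀ := le_max_right _ _
    have hCC₀ : C ≤ C₀ := le_max_left _ _
    have hK2 : (0 : ℝ) ≤ (K : ℝ) ^ (2 : ℕ) := by positivity
    have hTM : ((⌊C * ((S : ℕ) : ℝ) ^ (2 - ε) + C⌋₊ : ℕ) : ℝ) ≤ C₀ * ((K : ℝ) ^ (2 : ℕ) * P) + C₀ := by
      have hr0 : (0 : ℝ) ≤ ((S : ℕ) : ℝ) ^ (2 - ε) := Real.rpow_nonneg (Nat.cast_nonneg _) _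
      rcases le_or_gt 0 (C * ((S : ℕ) : ℝ) ^ (2 - ε) + C) with h0 | h0
      · calc ((⌊C * ((S : ℕ) : ℝ) ^ (2 - ε) + C⌋₊ : ℕ) : ℝ) ≤ C * ((S : ℕ) : ℝ) ^ (2 - ε) + C := Nat.floor_le h0
          _ ≤ C₀ * ((S : ℕ) : ℝ) ^ (2 - ε) + C₀ := add_le_add (mul_le_mul_of_nonneg_right hCC₀ hr0) hCC₀
          _ ≤ C₀ * ((K : ℝ) ^ (2 : ℕ) * P) + C₀ := add_le_add_left (mul_le_mul_of_nonneg_left hpow hC₀0) _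
      · rw [Nat.floor_of_nonpos h0.le, Nat.cast_zero]
        exact add_nonneg (mul_nonneg hC₀0 (mul_nonneg hK2 hP0)) hC₀0
    -- assemble
    have hcostR : ((Inline.simCost x.length (k' * w) (Ttot I + 1) ((cM.queries.map (Inline.charge (k' * w) O s)).sum)
        (readOut cM.mem).length : ℕ) : ℝ) ≤
        10000000000000000 * ((k' : ℝ) + 1) * (Tn : ℝ) + 38 * (C₀ * ((K : ℝ) ^ (2 : ℕ) * P) + C₀) := by
      have h' : ((10000000000000000 * (k' + 1) * Tn + 38 * ⌊C * ((S : ℕ) : ℝ) ^ (2 - ε) + C⌋₊ : ℕ) : ℝ) =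
          10000000000000000 * ((k' : ℝ) + 1) * (Tn : ℝ) + 38 * ((⌊C * ((S : ℕ) : ℝ) ^ (2 - ε) + C⌋₊ : ℕ) : ℝ) := by
        push_cast; ring
      have h'' : ((Inline.simCost x.length (k' * w) (Ttot I + 1) ((cM.queries.map (Inline.charge (k' * w) O s)).sum)
          (readOut cM.mem).length : ℕ) : ℝ) ≤
          ((10000000000000000 * (k' + 1) * Tn + 38 * ⌊C * ((S : ℕ) : ℝ) ^ (2 - ε) + C⌋₊ : ℕ) : ℝ) := by
        exact_mod_cast hcost
      rw [h'] at h''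
      linarith
    have hTnP : (Tn : ℝ) ≤ P := by rw [hTn]; exact habP
    have hk0 : (0 : ℝ) ≤ (k' : ℝ) := Nat.cast_nonneg _
    calc _ ≤ 10000000000000000 * ((k' : ℝ) + 1) * (Tn : ℝ) + 38 * (C₀ * ((K : ℝ) ^ (2 : ℕ) * P) + C₀) := hcostR
      _ ≤ 10000000000000000 * ((k' : ℝ) + 1) * P + 38 * (C₀ * ((K : ℝ) ^ (2 : ℕ) * P) + C₀ * P) := by
          have hcoef : (0 : ℝ) ≤ 10000000000000000 * ((k' : ℝ) + 1) := mul_nonneg (by norm_num) (by linarith)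
          have e1 : 10000000000000000 * ((k' : ℝ) + 1) * (Tn : ℝ) ≤ 10000000000000000 * ((k' : ℝ) + 1) * P :=
            mul_le_mul_of_nonneg_left hTnP hcoef
          have e2 : C₀ ≤ C₀ * P := le_mul_of_one_le_right hC₀0 h1P
          have e3 : 38 * (C₀ * ((K : ℝ) ^ (2 : ℕ) * P) + C₀) ≤ 38 * (C₀ * ((K : ℝ) ^ (2 : ℕ) * P) + C₀ * P) := by
            apply mul_le_mul_of_nonneg_left _ (by norm_num)
            exact add_le_add_right e2 _
          exact add_le_add e1 e3
      _ = (10000000000000000 * ((k' : ℝ) + 1) + 38 * C₀ * ((K : ℝ) ^ (2 : ℕ) + 1)) * P := by ring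
  -- the simulation theorem
  have key := Inline.outputsWithin_SIM M_isDeterministic hBdet hBof n2 n3 n4 n5 n6 n7 n8 n9 n10
    (Nat.le_add_left _ _) n11 hHalt n12 hOq hMBq noOracle zeroCoins hTcost
  refine ⟨readOut cM.mem, ?_, by rw [hwidth]; exact key⟩
  rw [hout, DiamRed.OV_good_eq, Set.mem_singleton_iff]

end EDRed

/-- **fine-grained.S14, discharged** (A. Backurs, P. Indyk, *Edit distance cannot be computed in
strongly subquadratic time (unless SETH is false)*, STOC 2015, **Thm. 1**; binary alphabet:
K. Bringmann, M. Künnemann, FOCS 2015, Thm. 1.2): assuming word-RAM SETH, for every `ε > 0` there is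
no deterministic `O(n^{2-ε})`-time word-RAM program computing the edit distance of two binary strings
of total length `n` (`Cryptography.EditDistance`). Proof: word-RAM SETH ⇒ OVH by Williams'
split-and-list reduction in polynomial dimension (`ovhWordRAM_of_sethWordRAM_holds`,
`OVPolyDimProofs`; BK15 Lemma 2.1), and OVH ⇒ no subquadratic binary edit distance by the reduction
of this file (`EDRed.ovInTimePolyDim_of_editDistance_inTimeO_holds`: coordinate values BK15 Lemma 5.2
and alignment gadget Lemmas 5.3–5.4 (`BKGadget`, `BKGadgetProofs`), the three gadget levels of the
proof of Thm. 3.3 (`EditDistanceOVGadgets`), the word-RAM program `EditDistOVProgram`/`EditDistOVRun`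
and the inline simulation of the edit-distance algorithm); all in the one machine model of the
sources, the word RAM (assembly `not_editDistance_inTimeO_of_sethWordRAM_of`, `EditDistanceSETH`).
[cite: BackursIndykSTOC2015, Thm. 1 (Thm. 3 + Williams 2005, Thm. 5.1)]
[cite: BringmannKunnemannFOCS2015, Thm. 1.2 (= Thm. 3.3 + §5.2 + Lemma 2.1)] -/
theorem not_editDistance_inTimeO_of_sethWordRAM_holds : not_editDistance_inTimeO_of_sethWordRAM :=
  not_editDistance_inTimeO_of_sethWordRAM_of ovhWordRAM_of_sethWordRAM_holds
    EDRed.ovInTimePolyDim_of_editDistance_inTimeO_holds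

end Literature.Computability.FineGrained
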